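import Mathlib.MeasureTheory.Measure.Lebesgue.EqHaar
import Literature.NumberTheory.Transcendental.KZSemiCanonicalReductionProofs
import Literature.NumberTheory.Transcendental.SemialgebraicGrounding
import Literature.ModelTheory.ExponentialFields.CylindricalDecompositionProofs
import HarnessLib

/-!
# Grounding inside the Kontsevich–Zagier calculus (proof file)

Fourth proof file around the named fact `KZ.semiCanonicalReduction` [Viu-Sos 2021, Thm. 1.1]
(`KZVolumeConjecture.lean`). The printed step (b) of its proof — *separation of poles* by
Hironaka's embedded resolution [Viu-Sos 2021, Prop. 2.2 / Cor. 2.2] — is replaced in the tree by a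
resolution-free argument in two halves: (i) THIS FILE: every representation `∫_S 1` of finite
volume in dimension `m + 1` differs by KZ relations from `∫_D 1` with `D` the *grounding* of `S`
(`SemialgebraicGrounding.lean`: a `ℚ`-semialgebraic coordinatewise down-set of the open positive
orthant with `vol D = vol S`); (ii) `KZMonomialCompression.lean`: such a `D` differs by relations
from `∫_B 1` with `B` bounded.

**Grounding the last coordinate is a chain of moves** (`KZ.of_sub_of_mem_relations_groundLast`).
Take a cylindrical decomposition of `ℝ^m` adapted to `S` (Basu–Pollack–Roy Cor. 5.7, proved in
the tree: `IsSemialgebraic.exists_cylindricalDecomposition_holds`): over each cell `C` the set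
`S` is a finite union of graphs (null) and of bands `ξ_{j-1} < t < ξ_j` between consecutive
continuous semialgebraic sections. Cut `S` and `groundLast S` along the cylinders `C × ℝ`
(rule (1)); cells of measure zero carry null pieces (relations). Over a cell `C` of positive
measure every band of `S` has two finite boundaries (an infinite band over `C` would have
infinite volume), so by Newton–Leibniz along the last coordinate (rule (3), primitive `t`)
`[band_j, 1] ≡ [C, ξ_j − ξ_{j-1}]`; by additivity of the integrand (rule (1))
`∑_j [C, ξ_j − ξ_{j-1}] ≡ [C, L]` with `L = ∑_j (ξ_j − ξ_{j-1})` the fibre length; and by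
Newton–Leibniz again `[C, L] ≡ [{0 ≤ t ≤ L}, 1]`, which is `groundLast S` over `C` up to two null
graphs. **Coordinate permutations are moves** (`KZ.of_sub_of_mem_relations_perm`: rule (2) with a
permutation matrix, whose determinant has absolute value `1` because it preserves volume), so
grounding any coordinate (`Grounding.groundAt`, conjugation of `groundLast` by a transposition)
and all coordinates in turn (`Grounding.groundIter`) are chains of moves
(`KZ.exists_downset_sub_mem_relations`).

## Main statements (all proved; no definition, no named fact)

* `KZ.of_sub_sum_integrand_mem_relations` — iterated additivity of the integrand over a `Finset`;
* `KZ.of_sub_sum_cyl_mem_relations` — cutting a representation along the cylinders over a finite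
  partition of the base (iterated domain additivity);
* `KZ.of_sub_of_mem_relations_perm` — coordinate permutations are moves;
* `KZ.volume_fibre_eq_ofReal_sum` — over a cell of positive measure the fibre length of `S` is the
  sum of the widths of its bands;
* `KZ.of_sub_of_mem_relations_groundLast`, `KZ.of_sub_of_mem_relations_groundAt`,
  `KZ.of_sub_of_mem_relations_groundIter` — grounding is a chain of moves;
* `KZ.exists_downset_sub_mem_relations` — **every finite-volume representation `∫_S 1` is
  KZ-equivalent to `∫_D 1` for a `ℚ`-semialgebraic down-set `D` of the open positive orthant**.

## References

* J. Viu-Sos, *A semi-canonical reduction for periods of Kontsevich–Zagier*, Int. J. Number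
  Theory 17 (2021) 147–174 (arXiv:1509.01097), Thm. 1.1, Prop. 2.2, Cor. 2.2 (the step replaced).
* M. Kontsevich, D. Zagier, *Periods* (2001), §1.2 (the rules).
* S. Basu, R. Pollack, M.-F. Roy, *Algorithms in Real Algebraic Geometry* (2006), Cor. 5.7.
* M. Yoshinaga, *Periods and elementary real numbers*, arXiv:0805.0349 (2008), §3.
-/

noncomputable section

open MeasureTheory Set MvPolynomial Filter Topology
open scoped ENNReal
open Literature.ModelTheory.ExponentialFields

namespace Literature.NumberTheory.Transcendental

namespace KZ

variable {m n : ℕ}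

/-! ### Generalities -/

/-- A representation with integrand `1` on its domain has a domain of finite volume. [folklore] -/
theorem volume_ne_top_of_integrand_one (r : IntegralRep n) (h1 : ∀ x ∈ r.domain, r.integrand x = 1) :
    volume r.domain ≠ ⊤ := by
  have hint : IntegrableOn (fun _ => (1 : ℝ)) r.domain :=
    r.integrableOn.congr_fun (fun x hx => h1 x hx) (IntegralRep.measurableSet_domain_holds r)
  have h2 := hint.2
  unfold HasFiniteIntegral at h2
  rw [lintegral_const, Measure.restrict_apply_univ, enorm_one, one_mul] at h2
  exact h2.ne

/-- **Iterated additivity of the integrand over a finite index set** (rule (1)): if the `Rᵢ`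
(`i ∈ s`) have the domain of `r` and `r.integrand = ∑ᵢ Rᵢ.integrand` on it, then
`[r] − ∑ᵢ [Rᵢ] ∈ relations`. [Kontsevich–Zagier 2001, §1.2, rule (1)]
[cite: KontsevichZagier2001, §1.2 rule (1)] -/
theorem of_sub_sum_integrand_mem_relations {ι : Type*} (s : Finset ι) (R : ι → IntegralRep n) :
    ∀ r : IntegralRep n, (∀ i ∈ s, (R i).domain = r.domain) →
      EqOn r.integrand (fun x => ∑ i ∈ s, (R i).integrand x) r.domain →
      of r - ∑ i ∈ s, of (R i) ∈ relations := by
  classical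
  induction s using Finset.induction_on with
  | empty =>
    intro r _ h
    simp only [Finset.sum_empty, sub_zero]
    exact of_mem_relations_of_eqOn_zero r fun x hx => by simpa using h hx
  | insert a s ha ih =>
    intro r hd h
    -- the partial representation `[σ, ∑_{i ∈ s} Rᵢ]`
    let r' : IntegralRep n :=
      { domain := r.domain
        integrand := fun x => ∑ i ∈ s, (R i).integrand x
        isSemialgebraic_domain := r.isSemialgebraic_domain
        isSemialgebraicFunOn_integrand :=
          isSemialgebraicFunOn_finset_sum s r.isSemialgebraic_domain fun i hi =>
            hd i (Finset.mem_insert_of_mem hi) ▸ (R i).isSemialgebraicFunOn_integrand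
        integrableOn := integrable_finsetSum s fun i hi =>
          hd i (Finset.mem_insert_of_mem hi) ▸ (R i).integrableOn }
    have e1 : of r - of (R a) - of r' ∈ relations :=
      integrandAddRel_subset_relations ⟨n, r, R a, r', hd a (Finset.mem_insert_self a s), rfl,
        fun x hx => by
          show r.integrand x = (R a).integrand x + ∑ i ∈ s, (R i).integrand x
          rw [h hx]
          exact Finset.sum_insert ha, rfl⟩
    have e2 : of r' - ∑ i ∈ s, of (R i) ∈ relations :=
      ih r' (fun i hi => hd i (Finset.mem_insert_of_mem hi)) fun x _ => rfl
    rw [Finset.sum_insert ha]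
    have : of r - (of (R a) + ∑ i ∈ s, of (R i)) = (of r - of (R a) - of r') +
        (of r' - ∑ i ∈ s, of (R i)) := by abel
    rw [this]
    exact relations.add_mem e1 e2

/-- **Cutting along cylinders** (iterated domain additivity, rule (1)): if `𝒮` is a finite
partition of `ℝ^m` and `R_C` is `r` restricted to the cylinder `{z | init z ∈ C}` for `C ∈ 𝒮`,
then `[r] − ∑_C [R_C] ∈ relations`. [Kontsevich–Zagier 2001, §1.2, rule (1)]
[cite: KontsevichZagier2001, §1.2 rule (1)] -/
theorem of_sub_sum_cyl_mem_relations (r : IntegralRep (m + 1)) (𝒮 : Finset (Set (Fin m → ℝ)))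
    (hpart : Setoid.IsPartition (𝒮 : Set (Set (Fin m → ℝ))))
    (R : {C // C ∈ 𝒮} → IntegralRep (m + 1))
    (hRd : ∀ C, (R C).domain = r.domain ∩ {z | Fin.init z ∈ (C : Set (Fin m → ℝ))})
    (hRi : ∀ C, EqOn (R C).integrand r.integrand (R C).domain) :
    of r - ∑ C ∈ 𝒮.attach, of (R C) ∈ relations := by
  refine of_sub_sum_of_mem_relations 𝒮.attach r R (fun C _ => ?_) (fun C _ x hx => hRi C hx.1)
    ?_ ?_
  · rw [hRd, show (r.domain ∩ {z | Fin.init z ∈ (C : Set (Fin m → ℝ))}) \ r.domain = ∅ from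
      sdiff_eq_empty.mpr inter_subset_left, measure_empty]
  · have : r.domain \ ⋃ C ∈ 𝒮.attach, (R C).domain = ∅ := by
      refine sdiff_eq_empty.mpr fun z hz => ?_
      have hcov : (Fin.init z : Fin m → ℝ) ∈ ⋃₀ (𝒮 : Set (Set (Fin m → ℝ))) := by
        rw [hpart.sUnion_eq_univ]; exact mem_univ _
      obtain ⟨C, hC, hzC⟩ := mem_sUnion.1 hcov
      refine mem_iUnion₂.2 ⟨⟨C, hC⟩, Finset.mem_attach _ _, ?_⟩
      rw [hRd]
      exact ⟨hz, hzC⟩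
    rw [this, measure_empty]
  · intro C _ C' _ hne
    have hne' : (C : Set (Fin m → ℝ)) ≠ C' := fun h => hne (Subtype.ext h)
    have hdisj : Disjoint (C : Set (Fin m → ℝ)) C' := hpart.pairwiseDisjoint C.2 C'.2 hne'
    have : (R C).domain ∩ (R C').domain = ∅ := by
      rw [hRd, hRd]
      ext z
      simp only [mem_inter_iff, mem_setOf_eq, mem_empty_iff_false, iff_false, not_and, and_imp]
      intro _ hzC _ hzC'
      exact hdisj.ne_of_mem hzC hzC' rfl
    rw [this, measure_empty]

/-! ### Coordinate permutations are moves -/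

/-- **Coordinate permutations are change-of-variables moves.** For a permutation `σ` of the
coordinates and representations `r = (S, 1)`, `r' = (perm σ S, 1)`
(`Grounding.perm σ S = {y | y ∘ σ ∈ S}`, the image of `S` under the linear map `x ↦ x ∘ σ⁻¹`),
`[r] − [r'] ∈ relations`: rule (2) with a permutation matrix, which preserves Lebesgue measure and
hence has `|det| = 1` (`Measure.addHaar_image_continuousLinearMap`); when `vol S = 0` both sides
are null. [Kontsevich–Zagier 2001, §1.2, rule (2)] [cite: KontsevichZagier2001, §1.2 rule (2)] -/
theorem of_sub_of_mem_relations_perm (σ : Equiv.Perm (Fin (m + 1))) (r r' : IntegralRep (m + 1))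
    (h1 : ∀ x ∈ r.domain, r.integrand x = 1) (hd : r'.domain = Grounding.perm σ r.domain)
    (h1' : ∀ x ∈ r'.domain, r'.integrand x = 1) : of r - of r' ∈ relations := by
  have hSm : MeasurableSet r.domain := IntegralRep.measurableSet_domain_holds r
  have hvol : volume r'.domain = volume r.domain := by rw [hd, Grounding.volume_perm σ hSm]
  by_cases h0 : volume r.domain = 0
  · exact relations.sub_mem (of_mem_relations_of_volume_eq_zero r h0)
      (of_mem_relations_of_volume_eq_zero r' (hvol.trans h0))
  have hfin : volume r.domain ≠ ⊤ := volume_ne_top_of_integrand_one r h1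
  -- the linear map `x ↦ x ∘ σ⁻¹`
  set L : (Fin (m + 1) → ℝ) →L[ℝ] (Fin (m + 1) → ℝ) :=
    LinearMap.toContinuousLinearMap (LinearMap.funLeft ℝ ℝ σ.symm) with hL
  have hLapply : ∀ x, L x = x ∘ σ.symm := fun x => by
    rw [hL, LinearMap.coe_toContinuousLinearMap']
    rfl
  have himage : L '' r.domain = r'.domain := by
    rw [hd]
    ext y
    simp only [mem_image, hLapply, Grounding.mem_perm]
    constructor
    · rintro ⟨x, hx, rfl⟩
      have : (x ∘ σ.symm) ∘ σ = x := by ext i; simp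
      rwa [this]
    · intro hy
      refine ⟨y ∘ σ, hy, ?_⟩
      ext i; simp
  have hLsa : IsSemialgebraicMapOn ℚ r.domain L := by
    refine (isSemialgebraicMapOn_aeval r.isSemialgebraic_domain fun j => X (σ.symm j)).congr
      fun x _ => ?_
    rw [hLapply]
    ext j
    simp
  have hLinj : InjOn L r.domain := by
    intro x _ y _ hxy
    rw [hLapply, hLapply] at hxy
    have := congr_arg (fun f : Fin (m + 1) → ℝ => f ∘ σ) hxy
    simpa [Function.comp_assoc] using this
  -- `|det L| = 1` by volume preservation
  have hdet : |L.det| = 1 := by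
    have h := Measure.addHaar_image_continuousLinearMap volume L r.domain
    rw [himage, hvol] at h
    have h' : ENNReal.ofReal |LinearMap.det (L : (Fin (m + 1) → ℝ) →ₗ[ℝ] (Fin (m + 1) → ℝ))| = 1 := by
      have := (ENNReal.mul_eq_right h0 hfin).1 h.symm
      exact this
    exact ENNReal.ofReal_eq_one.1 h'
  refine changeOfVariablesRel_subset_relations ⟨m + 1, r, r', L, fun _ => L, hLsa,
    fun _ _ => L.hasFDerivWithinAt, hLinj, himage.symm, fun x hx => ?_, rfl⟩
  rw [h1 x hx, hdet, mul_one, h1' (L x) (himage ▸ mem_image_of_mem L hx)]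


/-! ### Bands of a cylindrical decomposition: boundaries and fibres -/

section Bands

variable {l : ℕ}

/-- The upper boundary of a band is never `-∞`: some real lies below it. [folklore] -/
theorem exists_coe_lt_bandUpper (ξ : Fin l → (Fin m → ℝ) → ℝ) (j : Fin (l + 1)) (x : Fin m → ℝ) :
    ∃ c : ℝ, (c : EReal) < bandUpper ξ j x := by
  rcases Fin.eq_castSucc_or_eq_last j with ⟨i, rfl⟩ | rfl
  · refine ⟨ξ i x - 1, ?_⟩
    rw [bandUpper_castSucc, EReal.coe_lt_coe_iff]
    linarith
  · exact ⟨0, by rw [bandUpper_last]; exact EReal.coe_lt_top 0⟩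

/-- The lower boundary of a band is never `+∞`: some real lies above it. [folklore] -/
theorem exists_bandLower_lt_coe (ξ : Fin l → (Fin m → ℝ) → ℝ) (j : Fin (l + 1)) (x : Fin m → ℝ) :
    ∃ c : ℝ, bandLower ξ j x < (c : EReal) := by
  rcases Fin.eq_zero_or_eq_succ j with rfl | ⟨i, rfl⟩
  · exact ⟨0, by rw [bandLower_zero]; exact EReal.bot_lt_coe 0⟩
  · refine ⟨ξ i x + 1, ?_⟩
    rw [bandLower_succ, EReal.coe_lt_coe_iff]
    linarith

/-- **An extreme band has fibres of infinite length**: if `j = 0` or `j = ℓ` (one boundary is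
infinite) then the vertical fibre `{t | ξ_{j-1} x < t < ξ_j x}` has infinite Lebesgue measure.
[folklore] -/
theorem volume_bandFibre_eq_top (ξ : Fin l → (Fin m → ℝ) → ℝ) {j : Fin (l + 1)}
    (hj : j = 0 ∨ j = Fin.last l) (x : Fin m → ℝ) :
    volume {t : ℝ | bandLower ξ j x < (t : EReal) ∧ (t : EReal) < bandUpper ξ j x} = ⊤ := by
  rcases hj with rfl | rfl
  · obtain ⟨c, hc⟩ := exists_coe_lt_bandUpper ξ 0 x
    refine eq_top_iff.2 (le_trans ?_ (measure_mono (show Iio c ⊆ _ from fun t ht => ?_)))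
    · rw [Real.volume_Iio]
    · exact ⟨by rw [bandLower_zero]; exact EReal.bot_lt_coe t,
        lt_trans (EReal.coe_lt_coe_iff.2 ht) hc⟩
  · obtain ⟨c, hc⟩ := exists_bandLower_lt_coe ξ (Fin.last l) x
    refine eq_top_iff.2 (le_trans ?_ (measure_mono (show Ioi c ⊆ _ from fun t ht => ?_)))
    · rw [Real.volume_Ioi]
    · exact ⟨lt_trans hc (EReal.coe_lt_coe_iff.2 ht), by rw [bandUpper_last]; exact EReal.coe_lt_top t⟩

/-- **Over a cell of positive measure, every band of a finite-volume set is an inner band**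
(`0 < j < ℓ`): otherwise its fibres over the cell have infinite length and, by Cavalieri's
principle, the set has infinite volume. [folklore] -/
theorem ne_zero_and_ne_last_of_bandOver_subset {S : Set (Fin (m + 1) → ℝ)} (hSm : MeasurableSet S)
    (hfin : volume S ≠ ⊤) {C : Set (Fin m → ℝ)} (hCm : MeasurableSet C) (hC0 : volume C ≠ 0)
    (ξ : Fin l → (Fin m → ℝ) → ℝ) {j : Fin (l + 1)} (hsub : bandOver C ξ j ⊆ S) :
    j ≠ 0 ∧ j ≠ Fin.last l := by
  by_contra h
  have hj : j = 0 ∨ j = Fin.last l := by tauto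
  have htop : ∀ x ∈ C, volume (FibreLength.fibre S x) = ⊤ := by
    intro x hx
    refine eq_top_iff.2 (le_trans (volume_bandFibre_eq_top ξ hj x).ge (measure_mono fun t ht => ?_))
    exact hsub (snoc_mem_bandOver_iff.2 ⟨hx, ht.1, ht.2⟩)
  apply hfin
  rw [Grounding.volume_eq_lintegral_fibre hSm]
  refine eq_top_iff.2 (le_trans ?_ (setLIntegral_le_lintegral C _))
  rw [setLIntegral_congr_fun hCm htop, setLIntegral_const, ENNReal.top_mul hC0]

/-- Consecutive bands do not overlap: for `j < j'` the upper boundary of the `j`-th band is at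
most the lower boundary of the `j'`-th (the sections increase). [folklore] -/
theorem bandUpper_le_bandLower_of_lt (ξ : Fin l → (Fin m → ℝ) → ℝ) {x : Fin m → ℝ}
    (hmono : StrictMono fun i => ξ i x) {j j' : Fin (l + 1)} (hjj' : j < j') :
    bandUpper ξ j x ≤ bandLower ξ j' x := by
  have hjl : j ≠ Fin.last l := fun h => (Fin.le_last j').not_gt (h ▸ hjj')
  have hj'0 : j' ≠ 0 := fun h => (Fin.zero_le j).not_gt (h ▸ hjj')
  rw [bandUpper_of_ne_last ξ j hjl, bandLower_of_ne_zero ξ j' hj'0, EReal.coe_le_coe_iff]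
  exact hmono.monotone ((Fin.castPred_le_pred_iff hjl hj'0).2 hjj')

/-- The vertical fibres of two distinct bands over the same point are disjoint. [folklore] -/
theorem disjoint_bandFibre (ξ : Fin l → (Fin m → ℝ) → ℝ) {x : Fin m → ℝ}
    (hmono : StrictMono fun i => ξ i x) {j j' : Fin (l + 1)} (hne : j ≠ j') :
    Disjoint {t : ℝ | bandLower ξ j x < (t : EReal) ∧ (t : EReal) < bandUpper ξ j x}
      {t : ℝ | bandLower ξ j' x < (t : EReal) ∧ (t : EReal) < bandUpper ξ j' x} := by
  rw [Set.disjoint_left]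
  intro t ht ht'
  rcases lt_or_gt_of_ne hne with h | h
  · exact lt_irrefl _ (lt_of_lt_of_le (lt_of_lt_of_le ht.2
      (bandUpper_le_bandLower_of_lt ξ hmono h)) ht'.1.le)
  · exact lt_irrefl _ (lt_of_lt_of_le (lt_of_lt_of_le ht'.2
      (bandUpper_le_bandLower_of_lt ξ hmono h)) ht.1.le)

/-- The vertical fibre of an inner band (`0 < j < ℓ`) is the open interval between its (finite)
boundaries. [folklore] -/
theorem bandFibre_eq_Ioo (ξ : Fin l → (Fin m → ℝ) → ℝ) {j : Fin (l + 1)} (h0 : j ≠ 0)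
    (hl : j ≠ Fin.last l) (x : Fin m → ℝ) :
    {t : ℝ | bandLower ξ j x < (t : EReal) ∧ (t : EReal) < bandUpper ξ j x} =
      Ioo (bandLower ξ j x).toReal (bandUpper ξ j x).toReal := by
  ext t
  rw [bandLower_of_ne_zero ξ j h0, bandUpper_of_ne_last ξ j hl, mem_setOf_eq, EReal.toReal_coe,
    EReal.toReal_coe, EReal.coe_lt_coe_iff, EReal.coe_lt_coe_iff, mem_Ioo]

/-- The width of an inner band is positive. [folklore] -/
theorem toReal_bandLower_lt_toReal_bandUpper (ξ : Fin l → (Fin m → ℝ) → ℝ) {x : Fin m → ℝ}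
    (hmono : StrictMono fun i => ξ i x) {j : Fin (l + 1)} (h0 : j ≠ 0) (hl : j ≠ Fin.last l) :
    (bandLower ξ j x).toReal < (bandUpper ξ j x).toReal := by
  rw [bandLower_of_ne_zero ξ j h0, bandUpper_of_ne_last ξ j hl, EReal.toReal_coe, EReal.toReal_coe]
  exact hmono (Fin.pred_lt_castPred h0 hl)

/-- **The fibre length over a cell is the total width of the bands.** If over `x` the vertical
fibre of `S` consists of the points `ξ_j x` (`j ∈ G`) and the inner bands `(ξ_{j-1} x, ξ_j x)`
(`j ∈ B`), then its length is `∑_{j ∈ B} (ξ_j x − ξ_{j-1} x)`. [folklore] -/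
theorem volume_fibre_eq_ofReal_sum {S : Set (Fin (m + 1) → ℝ)} (ξ : Fin l → (Fin m → ℝ) → ℝ)
    {x : Fin m → ℝ} (hmono : StrictMono fun i => ξ i x) (G : Finset (Fin l))
    (B : Finset (Fin (l + 1))) (hB : ∀ j ∈ B, j ≠ 0 ∧ j ≠ Fin.last l)
    (hfib : {t : ℝ | (Fin.snoc x t : Fin (m + 1) → ℝ) ∈ S} = (⋃ j ∈ G, {ξ j x}) ∪
      ⋃ j ∈ B, {t : ℝ | bandLower ξ j x < (t : EReal) ∧ (t : EReal) < bandUpper ξ j x}) :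
    volume (FibreLength.fibre S x) =
      ENNReal.ofReal (∑ j ∈ B, ((bandUpper ξ j x).toReal - (bandLower ξ j x).toReal)) := by
  show volume {t : ℝ | (Fin.snoc x t : Fin (m + 1) → ℝ) ∈ S} = _
  rw [hfib]
  -- the graphs contribute a finite set
  have hG : volume (⋃ j ∈ G, ({ξ j x} : Set ℝ)) = 0 :=
    (measure_biUnion_null_iff G.countable_toSet).2 fun j _ => measure_singleton _
  have hunion : volume ((⋃ j ∈ G, ({ξ j x} : Set ℝ)) ∪
      ⋃ j ∈ B, {t : ℝ | bandLower ξ j x < (t : EReal) ∧ (t : EReal) < bandUpper ξ j x}) =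
      volume (⋃ j ∈ B, {t : ℝ | bandLower ξ j x < (t : EReal) ∧ (t : EReal) < bandUpper ξ j x}) := by
    refine le_antisymm ((measure_union_le _ _).trans ?_) (measure_mono subset_union_right)
    rw [hG, zero_add]
  rw [hunion, measure_biUnion_finset (fun j _ j' _ hne => disjoint_bandFibre ξ hmono hne)
    (fun j hj => by rw [bandFibre_eq_Ioo ξ (hB j hj).1 (hB j hj).2]; exact measurableSet_Ioo),
    ENNReal.ofReal_sum_of_nonneg fun j hj =>
      (sub_pos.2 (toReal_bandLower_lt_toReal_bandUpper ξ hmono (hB j hj).1 (hB j hj).2)).le]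
  refine Finset.sum_congr rfl fun j hj => ?_
  rw [bandFibre_eq_Ioo ξ (hB j hj).1 (hB j hj).2, Real.volume_Ioo]

/-- **Newton–Leibniz down an inner band** (rule (3) with primitive `t`): for an inner band
`0 < j < ℓ` of a finite-volume set `S` over a `ℚ`-semialgebraic cell `C` with `ℚ`-semialgebraic
increasing sections, the representation `∫_{closed band} 1` and the base representation
`∫_C (ξ_j − ξ_{j-1})` exist and differ by a Newton–Leibniz move.
[Kontsevich–Zagier 2001, §1.2, rule (3)] [cite: KontsevichZagier2001, §1.2 rule (3)] -/
theorem exists_band_sub_base_mem_newtonLeibnizRel {S : Set (Fin (m + 1) → ℝ)}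
    (hfin : volume S ≠ ⊤) {C : Set (Fin m → ℝ)} (hC : IsSemialgebraic ℚ C)
    (ξ : Fin l → (Fin m → ℝ) → ℝ) (hξ : ∀ i, IsSemialgebraicFunOn ℚ C (ξ i))
    (hmono : ∀ x ∈ C, StrictMono fun i => ξ i x) {j : Fin (l + 1)} (h0 : j ≠ 0)
    (hl : j ≠ Fin.last l) (hsub : bandOver C ξ j ⊆ S) :
    ∃ (Bd : IntegralRep (m + 1)) (b : IntegralRep m),
      Bd.domain = KZlog.band C (fun x => (bandLower ξ j x).toReal) (fun x => (bandUpper ξ j x).toReal) ∧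
      (Bd.integrand = fun _ => 1) ∧ b.domain = C ∧
      (b.integrand = fun x => (bandUpper ξ j x).toReal - (bandLower ξ j x).toReal) ∧
      of Bd - of b ∈ newtonLeibnizRel := by
  set lo : (Fin m → ℝ) → ℝ := fun x => (bandLower ξ j x).toReal with hlo_def
  set hi : (Fin m → ℝ) → ℝ := fun x => (bandUpper ξ j x).toReal with hhi_def
  have hlo : ∀ x, lo x = ξ (j.pred h0) x := fun x => by
    simp only [hlo_def, bandLower_of_ne_zero ξ j h0, EReal.toReal_coe]
  have hhi : ∀ x, hi x = ξ (j.castPred hl) x := fun x => by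
    simp only [hhi_def, bandUpper_of_ne_last ξ j hl, EReal.toReal_coe]
  have hlosa : IsSemialgebraicFunOn ℚ C lo := (hξ _).congr fun x _ => (hlo x).symm
  have hhisa : IsSemialgebraicFunOn ℚ C hi := (hξ _).congr fun x _ => (hhi x).symm
  have hlt : ∀ x ∈ C, lo x < hi x := fun x hx =>
    toReal_bandLower_lt_toReal_bandUpper ξ (hmono x hx) h0 hl
  have hCm : MeasurableSet C := IsSemialgebraic.measurableSet_holds hC
  -- the closed band and its volume
  have hBsa : IsSemialgebraic ℚ (KZlog.band C lo hi) := KZlog.isSemialgebraic_band hlosa hhisa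
  have hBm : MeasurableSet (KZlog.band C lo hi) := IsSemialgebraic.measurableSet_holds hBsa
  have hcover : KZlog.band C lo hi ⊆ bandOver C ξ j ∪
      ({z | Fin.init z ∈ C ∧ z (Fin.last m) = lo (Fin.init z)} ∪
        {z | Fin.init z ∈ C ∧ z (Fin.last m) = hi (Fin.init z)}) := by
    intro z hz
    rw [KZlog.mem_band] at hz
    obtain ⟨hzC, h1, h2⟩ := hz
    rcases h1.lt_or_eq with h1 | h1
    · rcases h2.lt_or_eq with h2 | h2
      · refine Or.inl (mem_bandOver_iff.2 ⟨hzC, ?_, ?_⟩)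
        · rw [bandLower_of_ne_zero ξ j h0, EReal.coe_lt_coe_iff, ← hlo]; exact h1
        · rw [bandUpper_of_ne_last ξ j hl, EReal.coe_lt_coe_iff, ← hhi]; exact h2
      · exact Or.inr (Or.inr ⟨hzC, h2⟩)
    · exact Or.inr (Or.inl ⟨hzC, h1.symm⟩)
  have hvol : volume (KZlog.band C lo hi) ≠ ⊤ := by
    refine ((measure_mono hcover).trans_lt ?_).ne
    refine (measure_union_le _ _).trans_lt ?_
    rw [measure_union_null (volume_graph_eq_zero hlosa) (volume_graph_eq_zero hhisa), add_zero]
    exact (measure_mono hsub).trans_lt hfin.lt_top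
  let Bd : IntegralRep (m + 1) := ⟨KZlog.band C lo hi, fun _ => 1, hBsa,
    by simpa using isSemialgebraicFunOn_ratCast hBsa 1, integrableOn_const hvol⟩
  -- the base representation `∫_C (hi - lo)`
  have hlin : ∫⁻ x in C, ENNReal.ofReal (hi x - lo x) = volume (KZlog.band C lo hi) := by
    rw [Grounding.volume_eq_lintegral_fibre hBm, ← lintegral_indicator hCm]
    refine lintegral_congr fun x => ?_
    by_cases hx : x ∈ C
    · rw [indicator_of_mem hx]
      have : FibreLength.fibre (KZlog.band C lo hi) x = Icc (lo x) (hi x) := by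
        ext t
        simp [FibreLength.fibre, KZlog.snoc_mem_band, hx]
      rw [this, Real.volume_Icc]
    · rw [indicator_of_notMem hx]
      have : FibreLength.fibre (KZlog.band C lo hi) x = ∅ := by
        ext t
        simp [FibreLength.fibre, KZlog.snoc_mem_band, hx]
      rw [this, measure_empty]
  have hint : IntegrableOn (fun x => hi x - lo x) C := by
    refine ⟨aestronglyMeasurable_of_isSemialgebraicFunOn
      (IsSemialgebraicFunOn.sub_holds hhisa hlosa) hCm, ?_⟩
    rw [hasFiniteIntegral_iff_ofReal ((ae_restrict_mem hCm).mono fun x hx =>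
      (sub_pos.2 (hlt x hx)).le)]
    rw [hlin]
    exact hvol.lt_top
  let b : IntegralRep m := ⟨C, fun x => hi x - lo x, hC, IsSemialgebraicFunOn.sub_holds hhisa hlosa,
    hint⟩
  refine ⟨Bd, b, rfl, rfl, rfl, rfl, m, Bd, b, lo, hi, fun z => z (Fin.last m),
    isSemialgebraicFunOn_apply hBsa (Fin.last m), hlosa, hhisa, fun x hx => (hlt x hx).le, rfl,
    fun x _ => ?_, fun x _ t _ => ?_, fun x _ => by simp [b], rfl⟩
  · simp only [Fin.snoc_last]
    exact continuousOn_id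
  · simp only [Fin.snoc_last, Bd]
    exact hasDerivAt_id t

end Bands


/-! ### Grounding the last coordinate over one cell -/

/-- **Grounding over one cell.** Let `S` be `ℚ`-semialgebraic of finite volume, `C` a
`ℚ`-semialgebraic cell of `ℝ^m` with `ℚ`-semialgebraic increasing sections `ξ` over which the
vertical fibres of `S` are the graphs `j ∈ G` and the bands `j ∈ B` (the output of an adapted
cylindrical decomposition). Then `∫_{S ∩ (C × ℝ)} 1` and `∫_{groundLast S ∩ (C × ℝ)} 1` differ by
relations: both are null if `vol C = 0`; otherwise all bands are inner, and
`[S ∩ (C × ℝ)] ≡ ∑_{j ∈ B} [band_j] ≡ ∑_j [C, ξ_j − ξ_{j-1}] ≡ [C, L] ≡ [{0 ≤ t ≤ L}] ≡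
[groundLast S ∩ (C × ℝ)]` by rules (1), (3), (1), (3), (1), where `L = ∑_j (ξ_j − ξ_{j-1})` is
the fibre length (`volume_fibre_eq_ofReal_sum`). [Kontsevich–Zagier 2001, §1.2, rules (1), (3)]
[cite: KontsevichZagier2001, §1.2 rules (1),(3)] -/
theorem of_sub_of_mem_relations_cell {l : ℕ} {S : Set (Fin (m + 1) → ℝ)} (hS : IsSemialgebraic ℚ S)
    (hfin : volume S ≠ ⊤) {C : Set (Fin m → ℝ)} (hC : IsSemialgebraic ℚ C)
    (ξ : Fin l → (Fin m → ℝ) → ℝ) (hξ : ∀ i, IsSemialgebraicFunOn ℚ C (ξ i))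
    (hmono : ∀ x ∈ C, StrictMono fun i => ξ i x) (G : Finset (Fin l)) (B : Finset (Fin (l + 1)))
    (hBsub : ∀ j ∈ B, bandOver C ξ j ⊆ S) (hBsa : ∀ j, IsSemialgebraic ℚ (bandOver C ξ j))
    (hfib : ∀ x ∈ C, {t : ℝ | (Fin.snoc x t : Fin (m + 1) → ℝ) ∈ S} = (⋃ j ∈ G, {ξ j x}) ∪
      ⋃ j ∈ B, {t : ℝ | bandLower ξ j x < (t : EReal) ∧ (t : EReal) < bandUpper ξ j x})
    (r r' : IntegralRep (m + 1)) (hrd : r.domain = S ∩ {z | Fin.init z ∈ C})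
    (hr1 : ∀ x ∈ r.domain, r.integrand x = 1)
    (hr'd : r'.domain = Grounding.groundLast S ∩ {z | Fin.init z ∈ C})
    (hr'1 : ∀ x ∈ r'.domain, r'.integrand x = 1) : of r - of r' ∈ relations := by
  classical
  have hSm : MeasurableSet S := IsSemialgebraic.measurableSet_holds hS
  have hCm : MeasurableSet C := IsSemialgebraic.measurableSet_holds hC
  by_cases hC0 : volume C = 0
  · -- both pieces are null
    have hcyl := volume_setOf_init_mem_eq_zero (n := m) hC0
    refine relations.sub_mem (of_mem_relations_of_volume_eq_zero r ?_)
      (of_mem_relations_of_volume_eq_zero r' ?_)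
    · rw [hrd]; exact measure_mono_null inter_subset_right hcyl
    · rw [hr'd]; exact measure_mono_null inter_subset_right hcyl
  -- all bands over `C` are inner
  have hinner : ∀ j ∈ B, j ≠ 0 ∧ j ≠ Fin.last l := fun j hj =>
    ne_zero_and_ne_last_of_bandOver_subset hSm hfin hCm hC0 ξ (hBsub j hj)
  -- Step 1: cut `S ∩ (C × ℝ)` into its open bands
  have hOb : ∀ j : {j // j ∈ B}, ∃ Ob : IntegralRep (m + 1),
      Ob.domain = bandOver C ξ j ∧ Ob.integrand = fun _ => 1 := fun j =>
    exists_oneRep (hBsa j) ((measure_mono (hBsub j j.2)).trans_lt hfin.lt_top).ne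
  choose Ob hObd hObi using hOb
  have e1 : of r - ∑ j ∈ B.attach, of (Ob j) ∈ relations := by
    refine of_sub_sum_of_mem_relations B.attach r Ob (fun j _ => ?_) (fun j _ x hx => ?_) ?_ ?_
    · rw [hObd, hrd, show bandOver C ξ j \ (S ∩ {z | Fin.init z ∈ C}) = ∅ from
        sdiff_eq_empty.mpr fun z hz => ⟨hBsub j j.2 hz, (mem_bandOver_iff.1 hz).1⟩, measure_empty]
    · rw [hObi, hr1 x hx.2]
    · have hsub : r.domain \ ⋃ j ∈ B.attach, (Ob j).domain ⊆
          ⋃ j ∈ G, {z : Fin (m + 1) → ℝ | Fin.init z ∈ C ∧ z (Fin.last m) = ξ j (Fin.init z)} := by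
        intro z hz
        rw [hrd] at hz
        obtain ⟨⟨hzS, hzC⟩, hzU⟩ := hz
        have hzC : Fin.init z ∈ C := hzC
        have ht : z (Fin.last m) ∈ {t : ℝ | (Fin.snoc (Fin.init z) t : Fin (m + 1) → ℝ) ∈ S} := by
          show Fin.snoc (Fin.init z) (z (Fin.last m)) ∈ S
          rw [Fin.snoc_init_self]; exact hzS
        rw [hfib _ hzC] at ht
        rcases ht with ht | ht
        · simp only [mem_iUnion, mem_singleton_iff, exists_prop] at ht
          obtain ⟨j, hj, hjt⟩ := ht
          exact mem_iUnion₂.2 ⟨j, hj, hzC, hjt⟩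
        · simp only [mem_iUnion, mem_setOf_eq, exists_prop] at ht
          obtain ⟨j, hj, hjt⟩ := ht
          exact absurd (mem_iUnion₂.2 ⟨⟨j, hj⟩, Finset.mem_attach _ _, by
            rw [hObd]; exact ⟨hzC, hjt.1, hjt.2⟩⟩) hzU
      refine measure_mono_null hsub ((measure_biUnion_null_iff G.countable_toSet).2 fun j _ => ?_)
      exact volume_graph_eq_zero (hξ j)
    · intro j _ j' _ hne
      have hne' : (j : Fin (l + 1)) ≠ j' := fun h => hne (Subtype.ext h)
      have : (Ob j).domain ∩ (Ob j').domain = ∅ := by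
        rw [hObd, hObd]
        ext z
        simp only [mem_inter_iff, mem_empty_iff_false, iff_false, not_and]
        intro hz hz'
        rw [mem_bandOver_iff] at hz hz'
        exact (Set.disjoint_left.1 (disjoint_bandFibre ξ (hmono _ hz.1) hne')) ⟨hz.2.1, hz.2.2⟩
          ⟨hz'.2.1, hz'.2.2⟩
      rw [this, measure_empty]
  -- Step 2: close the bands (null modification) and go down by Newton–Leibniz
  have hBb : ∀ j : {j // j ∈ B}, ∃ (Bd : IntegralRep (m + 1)) (b : IntegralRep m),
      Bd.domain = KZlog.band C (fun x => (bandLower ξ j x).toReal) (fun x => (bandUpper ξ j x).toReal) ∧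
      (Bd.integrand = fun _ => 1) ∧ b.domain = C ∧
      (b.integrand = fun x => (bandUpper ξ j x).toReal - (bandLower ξ j x).toReal) ∧
      of Bd - of b ∈ newtonLeibnizRel := fun j =>
    exists_band_sub_base_mem_newtonLeibnizRel hfin hC ξ hξ hmono (hinner j j.2).1 (hinner j j.2).2
      (hBsub j j.2)
  choose Bd b hBdd hBdi hbd hbi hNL using hBb
  have e2 : ∀ j : {j // j ∈ B}, of (Ob j) - of (Bd j) ∈ relations := by
    intro j
    have h0 := (hinner j j.2).1
    have hl := (hinner j j.2).2
    refine of_sub_of_mem_relations_of_null (Ob j) (Bd j) ?_ ?_ fun z _ => by rw [hObi, hBdi]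
    · rw [hObd, hBdd, show bandOver C ξ j \ KZlog.band C (fun x => (bandLower ξ j x).toReal)
          (fun x => (bandUpper ξ j x).toReal) = ∅ from sdiff_eq_empty.mpr fun z hz => ?_, measure_empty]
      rw [mem_bandOver_iff, bandLower_of_ne_zero ξ j h0, bandUpper_of_ne_last ξ j hl,
        EReal.coe_lt_coe_iff, EReal.coe_lt_coe_iff] at hz
      rw [KZlog.mem_band, bandLower_of_ne_zero ξ j h0, bandUpper_of_ne_last ξ j hl, EReal.toReal_coe,
        EReal.toReal_coe]
      exact ⟨hz.1, hz.2.1.le, hz.2.2.le⟩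
    · have hlosa : IsSemialgebraicFunOn ℚ C fun x => (bandLower ξ j x).toReal :=
        (hξ (Fin.pred j h0)).congr fun x _ => by rw [bandLower_of_ne_zero ξ j h0, EReal.toReal_coe]
      have hhisa : IsSemialgebraicFunOn ℚ C fun x => (bandUpper ξ j x).toReal :=
        (hξ (Fin.castPred j hl)).congr fun x _ => by rw [bandUpper_of_ne_last ξ j hl, EReal.toReal_coe]
      refine measure_mono_null (fun z hz => ?_)
        (measure_union_null (volume_graph_eq_zero hlosa) (volume_graph_eq_zero hhisa))
      rw [hBdd, hObd] at hz
      obtain ⟨hz, hz'⟩ := hz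
      rw [KZlog.mem_band] at hz
      obtain ⟨hzC, h1, h2⟩ := hz
      rcases h1.lt_or_eq with h1 | h1
      · rcases h2.lt_or_eq with h2 | h2
        · refine absurd (mem_bandOver_iff.2 ⟨hzC, ?_, ?_⟩) hz'
          · rw [bandLower_of_ne_zero ξ j h0, EReal.coe_lt_coe_iff]
            rwa [bandLower_of_ne_zero ξ j h0, EReal.toReal_coe] at h1
          · rw [bandUpper_of_ne_last ξ j hl, EReal.coe_lt_coe_iff]
            rwa [bandUpper_of_ne_last ξ j hl, EReal.toReal_coe] at h2
        · exact Or.inr ⟨hzC, h2⟩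
      · exact Or.inl ⟨hzC, h1.symm⟩
  -- Step 3: add up the widths: the fibre length `L` over `C`
  let bL : IntegralRep m :=
    { domain := C
      integrand := fun x => ∑ j ∈ B.attach, (b j).integrand x
      isSemialgebraic_domain := hC
      isSemialgebraicFunOn_integrand := isSemialgebraicFunOn_finset_sum B.attach hC fun j _ =>
        hbd j ▸ (b j).isSemialgebraicFunOn_integrand
      integrableOn := integrable_finsetSum B.attach fun j _ => hbd j ▸ (b j).integrableOn }
  have e3 : of bL - ∑ j ∈ B.attach, of (b j) ∈ relations :=
    of_sub_sum_integrand_mem_relations B.attach b bL (fun j _ => hbd j) fun x _ => rfl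
  have hL : ∀ x, bL.integrand x = ∑ j ∈ B, ((bandUpper ξ j x).toReal - (bandLower ξ j x).toReal) := by
    intro x
    show ∑ j ∈ B.attach, (b j).integrand x = _
    simp_rw [hbi]
    exact Finset.sum_attach B fun j => (bandUpper ξ j x).toReal - (bandLower ξ j x).toReal
  have hL0 : ∀ x ∈ C, 0 ≤ bL.integrand x := fun x hx => by
    rw [hL]
    exact Finset.sum_nonneg fun j hj => (sub_pos.2 (toReal_bandLower_lt_toReal_bandUpper ξ
      (hmono x hx) (hinner j hj).1 (hinner j hj).2)).le
  -- Step 4: up again by Newton–Leibniz: the region under the graph of `L`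
  obtain ⟨UG, hUGd, hUGi, hUG⟩ := exists_underGraph bL hL0
  -- Step 5: this is `groundLast S` over `C` up to two null graphs
  have hlen : ∀ x ∈ C, volume (FibreLength.fibre S x) = ENNReal.ofReal (bL.integrand x) :=
    fun x hx => by rw [hL]; exact volume_fibre_eq_ofReal_sum ξ (hmono x hx) G B hinner (hfib x hx)
  have e5 : of UG - of r' ∈ relations := by
    refine of_sub_of_mem_relations_of_null UG r' ?_ ?_ fun z hz => by rw [hUGi, hr'1 z hz.2]
    · have hzero : IsSemialgebraicFunOn ℚ C fun _ => (0 : ℝ) := by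
        simpa using isSemialgebraicFunOn_ratCast hC 0
      refine measure_mono_null (fun z hz => ?_) (measure_union_null (volume_graph_eq_zero hzero)
        (volume_graph_eq_zero bL.isSemialgebraicFunOn_integrand))
      rw [hUGd, hr'd] at hz
      obtain ⟨hz, hz'⟩ := hz
      rw [KZlog.mem_band] at hz
      obtain ⟨hzC, h1, h2⟩ := hz
      rcases h1.lt_or_eq with h1 | h1
      · rcases h2.lt_or_eq with h2 | h2
        · refine absurd ⟨Grounding.mem_groundLast_iff.2 ⟨h1, ?_⟩, hzC⟩ hz'
          rw [hlen _ hzC]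
          exact (ENNReal.ofReal_lt_ofReal_iff_of_nonneg h1.le).2 h2
        · exact Or.inr ⟨hzC, h2⟩
      · exact Or.inl ⟨hzC, h1.symm⟩
    · rw [hr'd, hUGd, show (Grounding.groundLast S ∩ {z | Fin.init z ∈ C}) \
          KZlog.band bL.domain (fun _ => 0) bL.integrand = ∅ from sdiff_eq_empty.mpr fun z hz => ?_,
        measure_empty]
      obtain ⟨hzG, hzC⟩ := hz
      have hzC : Fin.init z ∈ C := hzC
      rw [Grounding.mem_groundLast_iff, hlen _ hzC, ENNReal.ofReal_lt_ofReal_iff'] at hzG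
      exact KZlog.mem_band.2 ⟨hzC, hzG.1.le, hzG.2.1.le⟩
  -- assembly
  have e2' : ∑ j ∈ B.attach, of (Ob j) - ∑ j ∈ B.attach, of (Bd j) ∈ relations :=
    sum_sub_sum_mem_relations _ _ _ fun j _ => e2 j
  have eNL : ∑ j ∈ B.attach, of (Bd j) - ∑ j ∈ B.attach, of (b j) ∈ relations :=
    sum_sub_sum_mem_relations _ _ _ fun j _ => newtonLeibnizRel_subset_relations (hNL j)
  have : of r - of r' = (of r - ∑ j ∈ B.attach, of (Ob j)) +
      (∑ j ∈ B.attach, of (Ob j) - ∑ j ∈ B.attach, of (Bd j)) +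
      (∑ j ∈ B.attach, of (Bd j) - ∑ j ∈ B.attach, of (b j)) -
      (of bL - ∑ j ∈ B.attach, of (b j)) - (of UG - of bL) + (of UG - of r') := by abel
  rw [this]
  exact relations.add_mem (relations.sub_mem (relations.sub_mem (relations.add_mem
    (relations.add_mem e1 e2') eNL) e3) (newtonLeibnizRel_subset_relations hUG)) e5


/-! ### Grounding the last coordinate, any coordinate, all coordinates -/

/-- **Grounding the last coordinate is a chain of moves.** For a representation `r = (S, 1)`
(so `S` is `ℚ`-semialgebraic of finite volume) and `r' = (groundLast S, 1)`, `[r] − [r'] ∈ relations`: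
cut both along the cylinders over the cells of a cylindrical decomposition of `ℝ^m` adapted to
`S` (`IsSemialgebraic.exists_cylindricalDecomposition_holds`, rule (1)) and treat each cell by
`of_sub_of_mem_relations_cell`. [Kontsevich–Zagier 2001, §1.2, rules (1), (3); Basu–Pollack–Roy
2006, Cor. 5.7] [cite: KontsevichZagier2001, §1.2 rules (1),(3)] -/
theorem of_sub_of_mem_relations_groundLast (r r' : IntegralRep (m + 1))
    (h1 : ∀ x ∈ r.domain, r.integrand x = 1)
    (hd : r'.domain = Grounding.groundLast r.domain)
    (h1' : ∀ x ∈ r'.domain, r'.integrand x = 1) : of r - of r' ∈ relations := by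
  classical
  have hS : IsSemialgebraic ℚ r.domain := r.isSemialgebraic_domain
  have hfin : volume r.domain ≠ ⊤ := volume_ne_top_of_integrand_one r h1
  obtain ⟨𝒮, l, ξ, hcd, -, hξ, hmono, hcells, hfib⟩ :=
    IsSemialgebraic.exists_cylindricalDecomposition.exists_fibre_eq
      (IsSemialgebraic.exists_cylindricalDecomposition_holds (k := ℚ)) hS
  have hpart := hcd.isPartition
  have h𝒮sa := hcd.isSemialgebraic
  -- the pieces of `r` and `r'` over the cells
  let R : {C // C ∈ 𝒮} → IntegralRep (m + 1) := fun C =>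
    r.restrict (r.domain ∩ {z | Fin.init z ∈ (C : Set (Fin m → ℝ))})
      (hS.inter (h𝒮sa C C.2).setOf_init_mem) inter_subset_left
  let R' : {C // C ∈ 𝒮} → IntegralRep (m + 1) := fun C =>
    r'.restrict (r'.domain ∩ {z | Fin.init z ∈ (C : Set (Fin m → ℝ))})
      (r'.isSemialgebraic_domain.inter (h𝒮sa C C.2).setOf_init_mem) inter_subset_left
  have eR : of r - ∑ C ∈ 𝒮.attach, of (R C) ∈ relations :=
    of_sub_sum_cyl_mem_relations r 𝒮 hpart R (fun C => rfl) fun C x _ => rfl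
  have eR' : of r' - ∑ C ∈ 𝒮.attach, of (R' C) ∈ relations :=
    of_sub_sum_cyl_mem_relations r' 𝒮 hpart R' (fun C => rfl) fun C x _ => rfl
  have ecell : ∀ C : {C // C ∈ 𝒮}, of (R C) - of (R' C) ∈ relations := by
    intro C
    obtain ⟨G, B, -, hBsub, hfibC⟩ := hfib C C.2
    exact of_sub_of_mem_relations_cell hS hfin (h𝒮sa C C.2) (ξ C) (hξ C C.2) (hmono C C.2) G B
      hBsub (hcells C C.2).2 hfibC (R C) (R' C) rfl (fun x hx => h1 x hx.1) (by rw [← hd]; rfl)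
      fun x hx => h1' x hx.1
  have esum : ∑ C ∈ 𝒮.attach, of (R C) - ∑ C ∈ 𝒮.attach, of (R' C) ∈ relations :=
    sum_sub_sum_mem_relations _ _ _ fun C _ => ecell C
  have : of r - of r' = (of r - ∑ C ∈ 𝒮.attach, of (R C)) +
      (∑ C ∈ 𝒮.attach, of (R C) - ∑ C ∈ 𝒮.attach, of (R' C)) -
      (of r' - ∑ C ∈ 𝒮.attach, of (R' C)) := by abel
  rw [this]
  exact relations.sub_mem (relations.add_mem eR esum) eR'

/-- **Grounding any coordinate is a chain of moves** (`Grounding.groundAt i` = conjugation of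
`groundLast` by the transposition `(i last)`, and coordinate permutations are moves).
[Kontsevich–Zagier 2001, §1.2, rules (1)–(3)] [cite: KontsevichZagier2001, §1.2 rules (1)-(3)] -/
theorem of_sub_of_mem_relations_groundAt (i : Fin (m + 1)) (r r' : IntegralRep (m + 1))
    (h1 : ∀ x ∈ r.domain, r.integrand x = 1)
    (hd : r'.domain = Grounding.groundAt i r.domain)
    (h1' : ∀ x ∈ r'.domain, r'.integrand x = 1) : of r - of r' ∈ relations := by
  set σ := Equiv.swap i (Fin.last m) with hσ
  have hS : IsSemialgebraic ℚ r.domain := r.isSemialgebraic_domain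
  have hSm : MeasurableSet r.domain := IntegralRep.measurableSet_domain_holds r
  have hfin : volume r.domain ≠ ⊤ := volume_ne_top_of_integrand_one r h1
  -- `T₁ = perm σ S`
  have hT₁ : IsSemialgebraic ℚ (Grounding.perm σ r.domain) := Grounding.isSemialgebraic_perm σ hS
  have hT₁m : MeasurableSet (Grounding.perm σ r.domain) := IsSemialgebraic.measurableSet_holds hT₁
  have hT₁v : volume (Grounding.perm σ r.domain) ≠ ⊤ := by rwa [Grounding.volume_perm σ hSm]
  obtain ⟨r₁, hr₁d, hr₁i⟩ := exists_oneRep hT₁ hT₁v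
  -- `T₂ = groundLast T₁`
  have hT₂ : IsSemialgebraic ℚ (Grounding.groundLast (Grounding.perm σ r.domain)) :=
    Grounding.isSemialgebraic_groundLast hT₁
  have hT₂v : volume (Grounding.groundLast (Grounding.perm σ r.domain)) ≠ ⊤ := by
    rwa [Grounding.volume_groundLast hT₁m (IsSemialgebraic.measurableSet_holds hT₂)]
  obtain ⟨r₂, hr₂d, hr₂i⟩ := exists_oneRep hT₂ hT₂v
  have e1 : of r - of r₁ ∈ relations :=
    of_sub_of_mem_relations_perm σ r r₁ h1 hr₁d fun x _ => by rw [hr₁i]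
  have e2 : of r₁ - of r₂ ∈ relations :=
    of_sub_of_mem_relations_groundLast r₁ r₂ (fun x _ => by rw [hr₁i]) (by rw [hr₂d, hr₁d])
      fun x _ => by rw [hr₂i]
  have e3 : of r₂ - of r' ∈ relations :=
    of_sub_of_mem_relations_perm σ r₂ r' (fun x _ => by rw [hr₂i]) (by rw [hd, hr₂d]; rfl) h1'
  have : of r - of r' = (of r - of r₁) + (of r₁ - of r₂) + (of r₂ - of r') := by abel
  rw [this]
  exact relations.add_mem (relations.add_mem e1 e2) e3

/-- **Grounding the coordinates one after the other is a chain of moves.**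
[Kontsevich–Zagier 2001, §1.2, rules (1)–(3)] [cite: KontsevichZagier2001, §1.2 rules (1)-(3)] -/
theorem of_sub_of_mem_relations_groundIter (k : ℕ) :
    ∀ r r' : IntegralRep (m + 1), (∀ x ∈ r.domain, r.integrand x = 1) →
      r'.domain = Grounding.groundIter r.domain k → (∀ x ∈ r'.domain, r'.integrand x = 1) →
      of r - of r' ∈ relations := by
  induction k with
  | zero =>
    intro r r' h1 hd h1'
    exact of_sub_of_mem_relations_of_eqOn hd fun x hx => by rw [h1 x hx, h1' x (hd ▸ hx)]
  | succ k ih =>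
    intro r r' h1 hd h1'
    obtain ⟨hk, hkv, -⟩ := Grounding.groundIter_spec r.isSemialgebraic_domain k
    have hfin : volume (Grounding.groundIter r.domain k) ≠ ⊤ := by
      rw [hkv]; exact volume_ne_top_of_integrand_one r h1
    obtain ⟨rk, hrkd, hrki⟩ := exists_oneRep hk hfin
    have e1 : of r - of rk ∈ relations := ih r rk h1 hrkd fun x _ => by rw [hrki]
    have e2 : of rk - of r' ∈ relations := by
      by_cases h : k < m + 1
      · refine of_sub_of_mem_relations_groundAt ⟨k, h⟩ rk r' (fun x _ => by rw [hrki]) ?_ h1'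
        rw [hd, hrkd, Grounding.groundIter, dif_pos h]
      · have hdom : r'.domain = rk.domain := by rw [hd, hrkd, Grounding.groundIter, dif_neg h]
        exact of_sub_of_mem_relations_of_eqOn hdom fun x hx => by rw [hrki, h1' x (hdom ▸ hx)]
    have : of r - of r' = (of r - of rk) + (of rk - of r') := by abel
    rw [this]
    exact relations.add_mem e1 e2

/-- **Every finite-volume representation `∫_S 1` is KZ-equivalent to `∫_D 1` for a down-set `D`.**
For `G` of dimension `m + 1` with integrand `1` on its (`ℚ`-semialgebraic, finite-volume) domain
there is a representation `D` with integrand `1` whose domain is a `ℚ`-semialgebraic subset of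
the open positive orthant that is a down-set for the coordinatewise order, with
`[G] − [D] ∈ relations`: `D` is the grounding of `G.domain` in all coordinates
(`Grounding.groundIter`, `Grounding.exists_downset_volume_eq`), reached by the moves
(`of_sub_of_mem_relations_groundIter`). First half of the tree's resolution-free substitute for
[Viu-Sos 2021, Prop. 2.2 / Cor. 2.2] in the proof of [Viu-Sos 2021, Thm. 1.1].
[cite: ViuSos2021, Thm. 1.1 (step Cor. 2.2, replaced)] -/
theorem exists_downset_sub_mem_relations (G : IntegralRep (m + 1))
    (h1 : ∀ x ∈ G.domain, G.integrand x = 1) :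
    ∃ D : IntegralRep (m + 1), (∀ x ∈ D.domain, ∀ i, 0 < x i) ∧
      (∀ x ∈ D.domain, ∀ y : Fin (m + 1) → ℝ, (∀ i, 0 < y i ∧ y i ≤ x i) → y ∈ D.domain) ∧
      (∀ x ∈ D.domain, D.integrand x = 1) ∧ of G - of D ∈ relations := by
  obtain ⟨hsa, hvol, hspec⟩ := Grounding.groundIter_spec G.isSemialgebraic_domain (m + 1)
  have hfin : volume (Grounding.groundIter G.domain (m + 1)) ≠ ⊤ := by
    rw [hvol]; exact volume_ne_top_of_integrand_one G h1
  obtain ⟨D, hDd, hDi⟩ := exists_oneRep hsa hfin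
  refine ⟨D, fun x hx i => ?_, fun x hx y hy => ?_, fun x _ => by rw [hDi],
    of_sub_of_mem_relations_groundIter (m + 1) G D h1 hDd fun x _ => by rw [hDi]⟩
  · rw [hDd] at hx
    exact (hspec i i.isLt).1 x hx
  · rw [hDd] at hx ⊢
    exact Grounding.mem_of_forall_update_mem (fun i => (hspec i i.isLt).2) hx hy

end KZ

end Literature.NumberTheory.Transcendental
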